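import Summits.ABC.StewartYu.PadicG3SchedS
import Summits.ABC.StewartYu.PadicG3CountG
import HarnessLib

/-!
# Cell abc-stewartyu, crux `Y07Odd` (stmt-ABC-19658), line `gen3-slab-odd`: the SIEGEL COUNT of the registered stub `stub_siegelCountG` reduced
# to ONE REAL INEQUALITY (the combinatorics — `#(Icc(−X₀,X₀) ×ˢ tauSet n T₀) ≤ (2X₀+1)·(T₀+n)^{n+1}/(n+1)!` — done here)

`Summits/ABC/StewartYu/PadicG3CountS.lean` (generic twin of `PadicG3CountG` over `D : G3Sched n`) — cell `abc-stewartyu` (seat p2-g4, F-odd lead).  Theorems only; no named fact.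
`siegelCountG_of_ineq`: if `2·(2X₀+1)·(T₀+n)^{n+1}/(n+1)!·((p−1)p^m) ≤ (L₀G+1)·∏(2·sideG j+1)` (reals) then the stub's count holds.

References: Yu. V. Nesterenko, LNM 1819 (2003) (3.30), (4.6); M. Waldschmidt, Acta Arith. 37 (1980) (3.6).
-/

noncomputable section

open Finset
open Literature.NumberTheory.Transcendental
open Literature.NumberTheory.Transcendental.CW77.Setup (Tau tauNorm tauSet)

namespace Summit.ABC.StewartYu

namespace G3Setup

variable {p : ℕ} [Fact p.Prime] (S : G3Setup p) (D : G3Sched S.n)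

/-- **The Siegel count from one real inequality.** [cite: Nesterenko2003, (3.30), (4.6); shape only] -/
theorem siegelCountS_of_ineq
    (h : 2 * ((2 * (S.NS D 0 0 : ℝ) + 1) * ((((S.TordS D 0 0 : ℕ) : ℝ) + S.n) ^ (S.n + 1) / (S.n + 1).factorial)) * (((p - 1 : ℕ) : ℝ) * (p : ℝ) ^ D.m) ≤
      ((D.L₀ : ℝ) + 1) * ∏ j, (2 * (S.sideS D j : ℝ) + 1)) :
    2 * (Icc (-(S.NS D 0 0 : ℤ)) (S.NS D 0 0) ×ˢ tauSet S.n (S.TordS D 0 0)).card * ((p - 1) * p ^ D.m) ≤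
      (D.L₀ + 1) * ∏ j, (2 * S.sideS D j + 1) := by
  have hc := S.card_eqs_le_real (S.NS D 0 0) (S.TordS D 0 0)
  have hreal : (2 * ((Icc (-(S.NS D 0 0 : ℤ)) (S.NS D 0 0) ×ˢ tauSet S.n (S.TordS D 0 0)).card : ℝ) * (((p - 1 : ℕ) : ℝ) * (p : ℝ) ^ D.m)) ≤
      ((D.L₀ : ℝ) + 1) * ∏ j, (2 * (S.sideS D j : ℝ) + 1) :=
    le_trans (mul_le_mul_of_nonneg_right (mul_le_mul_of_nonneg_left hc (by norm_num)) (by positivity)) h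
  exact_mod_cast hreal

end G3Setup

end Summit.ABC.StewartYu

end
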